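import Literature.MathematicalPhysics.QuantumLattice.RepKillingFormBridge
import Literature.MathematicalPhysics.QuantumFieldTheory.AsymptoticFreedomScale
import HarnessLib

/-!
# The two-loop asymptotic-freedom data of `(SU(N), fundamental)` for every `N ≥ 2`:
# `b₀ = 11N/(24π²)`, `b₁ = 17N²/(96π⁴)`, `a(β)Λ → 0`

Topic `Literature/MathematicalPhysics/QuantumFieldTheory`; sibling of `AsymptoticFreedomScale.lean`, which defines the
`G`-general coefficients `b₀(G,r) = 11λ/(48π²)`, `b₁(G,r) = 17λ²/(384π⁴)` and the two-loop unit `LatticeRep.afUnit r`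
on the adjoint-Casimir ratio `λ(G, r) = casimirRatio r`, and calibrates them at `SU(2)` only (`λ = 4`,
`RepKillingForm.casimirRatio_fundamentalLatticeRep_two`).  With `λ(SU(N), fund) = 2N` for all `N ≥ 2`
(`RepKillingFormBridge.casimirRatio_fundamentalLatticeRep`, Humphreys §6 Exercise 7 / Sepanski Exercise 6.19 (1)) the
same calibration holds for every `SU(N)`:

* `afCoeff₀_fundamentalLatticeRep`: `b₀(SU(N), fund) = 11·(2N)/(48π²) = 11N/(24π²)` — Montvay–Münster's
  `β₀ = (N/16π²)(11/3)` (3.261) for the coupling `g₀² = 2/β`, times `2` for this tree's `g̃² = 1/β = g₀²/2`;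
* `afCoeff₁_fundamentalLatticeRep`: `b₁(SU(N), fund) = 17·(2N)²/(384π⁴) = 17N²/(96π⁴)` (= `4·β₁` of (3.262));
* `casimirRatio_fundamentalLatticeRep_pos`, `tendsto_afUnit_fundamentalLatticeRep_atTop` (`a(β)Λ_L → 0`),
  `tendsto_afUnit_fundamentalLatticeRep_div` (ratio law `→ exp(t/(2b₀))`); the colour group: `afCoeff₀_fundamentalLatticeRep_three
  = 11/(8π²)`;
* for EVERY unitary representation of a compact group: `afCoeff₀_nonneg`, `afCoeff₁_nonneg` (from `0 ≤ λ(G,r)`,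
  `RepKillingFormBridge.casimirRatio_nonneg`).

Honest scope: arithmetic on definitions; no statement about any lattice measure (whether the `SU(N)` Wilson theory
follows `afUnit` is the open physics of asymptotic scaling).

**Sources (read at the cited places).** I. Montvay, G. Münster, *Quantum Fields on a Lattice* (1994) [MontvayMunster1994],
(3.261)–(3.262) (`β₀`, `β₁` for `SU(N)`), (3.265) (two-loop scale); J. E. Humphreys, GTM 9 [Humphreys1972], §6 Exercise 7.
-/

noncomputable section

open Real Filter
open scoped _root_.Topology
open Literature.MathematicalPhysics.QuantumLattice (casimirRatio fundamentalLatticeRep casimirRatio_nonneg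
  casimirRatio_fundamentalLatticeRep)

namespace Literature.MathematicalPhysics.QuantumFieldTheory

/-! ### §1 Every unitary representation of a compact group: `b₀, b₁ ≥ 0` -/

section General

variable {G : Type*} [Group G] [TopologicalSpace G] [CompactSpace G]

/-- `b₀(G, r) ≥ 0` for every unitary representation of a compact group (`λ(G,r) ≥ 0`: the Killing form of a compact
Lie algebra is negative semidefinite). [cite: MontvayMunster1994, (3.261)] -/
theorem LatticeRep.afCoeff₀_nonneg (r : LatticeRep G) : 0 ≤ r.afCoeff₀ := by
  rw [LatticeRep.afCoeff₀_def]
  have := casimirRatio_nonneg r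
  positivity

/-- `b₁(G, r) ≥ 0` for every unitary representation of a compact group. [cite: MontvayMunster1994, (3.262)] -/
theorem LatticeRep.afCoeff₁_nonneg (r : LatticeRep G) : 0 ≤ r.afCoeff₁ := by
  rw [LatticeRep.afCoeff₁_def]
  positivity

end General

/-! ### §2 `SU(N)`, fundamental representation, `N ≥ 2` -/

/-- **`b₀(SU(N), fund) = 11N/(24π²)`** (`= 11·λ/(48π²)` at `λ = 2N`; Montvay–Münster's `(N/16π²)(11/3)` for
`g₀² = 2/β`, doubled for `g̃² = 1/β`). [cite: MontvayMunster1994, (3.261)] -/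
theorem afCoeff₀_fundamentalLatticeRep {N : ℕ} (hN : 2 ≤ N) :
    (fundamentalLatticeRep N).afCoeff₀ = 11 * N / (24 * π ^ 2) := by
  rw [LatticeRep.afCoeff₀_def, casimirRatio_fundamentalLatticeRep hN]
  ring

/-- **`b₁(SU(N), fund) = 17N²/(96π⁴)`** (`= 17·λ²/(384π⁴)` at `λ = 2N`; four times Montvay–Münster's
`(N/16π²)²(34/3)` for `g₀² = 2/β`). [cite: MontvayMunster1994, (3.262)] -/
theorem afCoeff₁_fundamentalLatticeRep {N : ℕ} (hN : 2 ≤ N) :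
    (fundamentalLatticeRep N).afCoeff₁ = 17 * (N : ℝ) ^ 2 / (96 * π ^ 4) := by
  rw [LatticeRep.afCoeff₁_def, casimirRatio_fundamentalLatticeRep hN]
  ring

/-- The colour group: `b₀(SU(3), fund) = 11/(8π²)`. [cite: MontvayMunster1994, (3.261)] -/
theorem afCoeff₀_fundamentalLatticeRep_three : (fundamentalLatticeRep 3).afCoeff₀ = 11 / (8 * π ^ 2) := by
  rw [afCoeff₀_fundamentalLatticeRep (by norm_num : 2 ≤ 3)]
  push_cast
  ring

/-- `λ(SU(N), fund) = 2N > 0` for `N ≥ 2`. [cite: Humphreys1972, §6 Exercise 7] -/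
theorem casimirRatio_fundamentalLatticeRep_pos {N : ℕ} (hN : 2 ≤ N) : 0 < casimirRatio (fundamentalLatticeRep N) := by
  rw [casimirRatio_fundamentalLatticeRep hN]
  have : (0 : ℝ) < N := Nat.cast_pos.2 (by omega)
  positivity

/-- `b₀(SU(N), fund) > 0` for `N ≥ 2`. [cite: MontvayMunster1994, (3.261)] -/
theorem afCoeff₀_fundamentalLatticeRep_pos {N : ℕ} (hN : 2 ≤ N) : 0 < (fundamentalLatticeRep N).afCoeff₀ :=
  LatticeRep.afCoeff₀_pos (casimirRatio_fundamentalLatticeRep_pos hN)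

/-- **`a(β)Λ_L → 0` as `β → ∞` for `(SU(N), fund)`, `N ≥ 2`** (the two-loop unit `afUnit` tends to zero).
[cite: MontvayMunster1994, (3.265)] -/
theorem tendsto_afUnit_fundamentalLatticeRep_atTop {N : ℕ} (hN : 2 ≤ N) :
    Tendsto (fundamentalLatticeRep N).afUnit atTop (𝓝 0) :=
  LatticeRep.tendsto_afUnit_atTop (casimirRatio_fundamentalLatticeRep_pos hN)

/-- The ratio law for `(SU(N), fund)`, `N ≥ 2`: `afUnit c / afUnit (c + t) → exp(t/(2b₀))`, `b₀ = 11N/(24π²)`.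
[cite: MontvayMunster1994, (3.265)] -/
theorem tendsto_afUnit_fundamentalLatticeRep_div {N : ℕ} (hN : 2 ≤ N) (t : ℝ) :
    Tendsto (fun c : ℝ => (fundamentalLatticeRep N).afUnit c / (fundamentalLatticeRep N).afUnit (c + t)) atTop
      (𝓝 (Real.exp (t / (2 * (11 * N / (24 * π ^ 2)))))) := by
  rw [← afCoeff₀_fundamentalLatticeRep hN]
  exact LatticeRep.tendsto_afUnit_div_afUnit_add (casimirRatio_fundamentalLatticeRep_pos hN) t

end Literature.MathematicalPhysics.QuantumFieldTheory

end
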